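import Summits.CriticalPhenomena.PercolationContinuityZ3.Theorems.PercNearOneGluingNoHeavyPcintBSMXZ6Cert
import HarnessLib

/-!
# PCINT lane, PHASE 6 (block renewal with reach-two pieces): kernel check of the meeting-probability coefficients for `ℤ^6`

Cell `prim-pcint`, seat `prim-pcint-1` (gen 15); memo `run/shared/lean/prim/pcint/T-FIBRE-ROUTE.md` §PHASE 6.
Instance `d = 6 = 4 + 2` (`k = 4` time axes, the transverse plane), five-point law `(A₀, A₁, A₂)/DA =
(72, 12, 2)/100`, horizon `N = 150` (window half-width `60`), cell `p = 1463/10^4`. `u k i · DU ≤ U_i` and `c_i · DU ≤ C_i`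
(exact rationals from the tree's `OSM.vrow`).
-/

namespace Summit.CriticalPhenomena.PercolationContinuityZ3.Theorems.Pcint.BSMX.Z6

open Summit.CriticalPhenomena.PercolationContinuityZ3.Theorems.Pcint.BSMX Summit.CriticalPhenomena.PercolationContinuityZ3.Theorems.Pcint.BSM

set_option maxHeartbeats 0 in
set_option maxRecDepth 65536 in
/-- `u k i · DU ≤ U_i`. -/
theorem hU : ∀ i ∈ List.range 150, uqv (OSM.vrow 4 150) 4 i * 1000000000000000 ≤ (BSMX.Z6.Ul.getD i 0 : ℚ) := by
  decide +kernel

set_option maxHeartbeats 0 in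
set_option maxRecDepth 65536 in
/-- `c_i · DU ≤ C_i`. -/
theorem hC : ∀ i ∈ List.range 150, cadjqv (OSM.vrow 4 (150 + 1)) 4 i * 1000000000000000 ≤ (BSMX.Z6.Cl.getD i 0 : ℚ) := by
  decide +kernel

end Summit.CriticalPhenomena.PercolationContinuityZ3.Theorems.Pcint.BSMX.Z6
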